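import Literature.Geometry.Lorentzian.KerrSchildWaveCauchyProblem
import Literature.Geometry.Lorentzian.KerrSchildCoord

/-!
# Crux `AdiabaticMultiKerrILED` (line `Sketch`) — quadratic form of the tails-cut metric

Helper file for the crux `stmt-FinalStateConjecture-14310`
(`Summit.FinalStateConjecture.FinalStateConjecture.Theses.ClusterCompleteness.AdiabaticMultiKerrILED`),
line `Sketch`, stub `inverseMetric_quadratic_decomposition_tailsCut` (lead c7, wave 4, Morawetz
bricks).

In the rest frame of one zero-spin hole the tails-cut zone background of the crux is the
generalised Kerr–Schild field `G₀^{μν} = η^{μν} − μ(x) ℓ♯^μ ℓ♯^ν`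
(`KerrSchild.inverseMetric` with profile `μ(x) = χ(r) · 2H`, `χ(r) = Real.smoothTransition
(2 − r/(8M))`, `H = Kerr.scalarH M 0 x = M/r`, `r = Kerr.radius 0 x`) and the ingoing null vector
`ℓ♯ = Kerr.nullVector 0 x = (−1, x⃗/r)`. This is the static metric
`g = −f dT² + dr²/f + r² dΩ²`, `f = 1 − μ`, written in ingoing coordinates, and the Lagrangian
regrouping of the Morawetz bulk needs the decomposition of the quadratic form `G₀(dψ, dψ)` into its
time / tortoise-radial / angular parts:

`G₀(p, p) = −p₀²/f + (∂_{r*}ψ)²/f + |∇̸ψ|²`,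

with `∂_{r*}ψ = f (x⃗·∇ψ)/r + μ ∂₀ψ` and `|∇̸ψ|² = ∑ᵢ (∂ᵢψ)² − (x⃗·∇ψ/r)²`
(`inverseMetric_quadratic_decomposition_tailsCut`). The proof is pure algebra at the point `x`:
`G₀^{00} = −1 − μ`, `G₀^{0i} = μ xⁱ/r`, `G₀^{ij} = δ^{ij} − μ xⁱxʲ/r²`, so
`G₀(p, p) = −p₀² + |p⃗|² − μ (x⃗·p⃗/r − p₀)²`, which equals the right-hand side after clearing
the denominators `f ≠ 0` (from `μ < 1`) and `r ≠ 0`. Dafermos–Rodnianski arXiv:0811.0354, §4.1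
(the `(t, r*)` form of the Schwarzschild wave operator). [folklore]
-/

noncomputable section

-- the doubled `FinalStateConjecture.FinalStateConjecture` path component trips dupNamespace
set_option linter.dupNamespace false

open scoped BigOperators
open Literature.Geometry.Lorentzian

namespace Summit.FinalStateConjecture.FinalStateConjecture.Theorems

/-- For `a = 0` and `r = Kerr.radius 0 x > 0` the spatial components of the Kerr–Schild null
vector are `(ℓ♯)¹ = x¹/r`, `(ℓ♯)² = x²/r`, `(ℓ♯)³ = x³/r` (Visser arXiv:0706.0622, (34) at
`a = 0`). [folklore] -/
theorem quadDecomp_nullVector_zero_spatial {x : E4} (hx : 0 < Kerr.radius 0 x) :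
    Kerr.nullVector 0 x 1 = x 1 / Kerr.radius 0 x ∧ Kerr.nullVector 0 x 2 = x 2 / Kerr.radius 0 x ∧
      Kerr.nullVector 0 x 3 = x 3 / Kerr.radius 0 x := by
  have hr : Kerr.radius 0 x ≠ 0 := hx.ne'
  refine ⟨?_, ?_, ?_⟩ <;>
    simp only [Kerr.nullVector_apply_one, Kerr.nullVector_apply_two, Kerr.nullVector_apply_three,
      Kerr.nullCovectorFun, zero_mul, add_zero, sub_zero, sq, mul_div_mul_left _ _ hr, Fin.isValue,
      Matrix.cons_val_zero, Matrix.cons_val_one, Matrix.cons_val]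

/-- **Quadratic form of a generalised Kerr–Schild field.** For any profile `φ`, null vector field
`l` and covector `p`: `∑_{μν} (η^{μν} − φ l^μ l^ν) p_μ p_ν = −p₀² + p₁² + p₂² + p₃² − φ (l·p)²`
(Kerr–Schild 1965, §2). [folklore] -/
theorem quadDecomp_sum_inverseMetric_mul_mul (φ : E4 → ℝ) (l : E4 → E4) (x : E4)
    (p : Fin 4 → ℝ) :
    ∑ μ, ∑ ν, KerrSchild.inverseMetric φ l x μ ν * p μ * p ν =
      -p 0 ^ 2 + p 1 ^ 2 + p 2 ^ 2 + p 3 ^ 2 - φ x * (∑ μ, l x μ * p μ) ^ 2 := by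
  simp only [KerrSchild.inverseMetric, Kerr.etaComp, Fin.sum_univ_four, Fin.isValue]
  simp only [show (1 : Fin 4) ≠ 0 from by decide, show (2 : Fin 4) ≠ 0 from by decide,
    show (3 : Fin 4) ≠ 0 from by decide, show (0 : Fin 4) ≠ 1 from by decide,
    show (0 : Fin 4) ≠ 2 from by decide, show (0 : Fin 4) ≠ 3 from by decide,
    show (1 : Fin 4) ≠ 2 from by decide, show (1 : Fin 4) ≠ 3 from by decide,
    show (2 : Fin 4) ≠ 1 from by decide, show (2 : Fin 4) ≠ 3 from by decide,
    show (3 : Fin 4) ≠ 1 from by decide, show (3 : Fin 4) ≠ 2 from by decide, if_true, if_false]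
  ring

/-- **Time / tortoise-radial / angular decomposition of the quadratic form of the zero-spin
tails-cut zone metric.** With `μ = χ(r) · 2H` (`χ(r) = Real.smoothTransition (2 − r/(8M))`,
`r = Kerr.radius 0 x > 0`, `μ < 1`), `f = 1 − μ`, `p = dψ(x)`, `x⃗·p⃗ = ∑ᵢ xⁱ pᵢ`:
`∑_{μν} G₀^{μν} p_μ p_ν = −p₀²/f + (f (x⃗·p⃗)/r + μ p₀)²/f + (∑ᵢ pᵢ² − (x⃗·p⃗/r)²)` for
`G₀ = η − μ ℓ♯ ⊗ ℓ♯`, `ℓ♯ = (−1, x⃗/r)`; i.e. `G₀(p,p) = −(∂_T ψ)²/f + (∂_{r*}ψ)²/f + |∇̸ψ|²` for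
the static metric `−f dT² + dr²/f + r² dΩ²` in ingoing coordinates. Dafermos–Rodnianski
arXiv:0811.0354, §4.1. [folklore] -/
theorem inverseMetric_quadratic_decomposition_tailsCut : ∀ (M : ℝ) (ψ : E4 → ℝ) (x : E4), 0 < M → 0 < Kerr.radius 0 x → (Real.smoothTransition (2 - Kerr.radius 0 x / (8 * M)) * (2 * Kerr.scalarH M 0 x)) < 1 → (∑ μ, ∑ ν, (KerrSchild.inverseMetric (fun y ↦ Real.smoothTransition (2 - Kerr.radius 0 y / (8 * M)) * (2 * Kerr.scalarH M 0 y)) (Kerr.nullVector 0)) x μ ν * fderiv ℝ ψ x (E4.basisVector μ) * fderiv ℝ ψ x (E4.basisVector ν)) = -(fderiv ℝ ψ x (E4.basisVector 0) ^ 2 / (1 - (Real.smoothTransition (2 - Kerr.radius 0 x / (8 * M)) * (2 * Kerr.scalarH M 0 x)))) + ((1 - (Real.smoothTransition (2 - Kerr.radius 0 x / (8 * M)) * (2 * Kerr.scalarH M 0 x))) * (∑ i : Fin 3, x i.succ * fderiv ℝ ψ x (E4.basisVector i.succ)) / Kerr.radius 0 x + (Real.smoothTransition (2 - Kerr.radius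 0 x / (8 * M)) * (2 * Kerr.scalarH M 0 x)) * fderiv ℝ ψ x (E4.basisVector 0)) ^ 2 / (1 - (Real.smoothTransition (2 - Kerr.radius 0 x / (8 * M)) * (2 * Kerr.scalarH M 0 x))) + ((∑ i : Fin 3, fderiv ℝ ψ x (E4.basisVector i.succ) ^ 2) - ((∑ i : Fin 3, x i.succ * fderiv ℝ ψ x (E4.basisVector i.succ)) / Kerr.radius 0 x) ^ 2) := by
  intro M ψ x _hM hx hμ
  obtain ⟨hl1, hl2, hl3⟩ := quadDecomp_nullVector_zero_spatial hx
  rw [quadDecomp_sum_inverseMetric_mul_mul]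
  simp only [Fin.sum_univ_four, Fin.sum_univ_three, Fin.isValue, Fin.succ_zero_eq_one,
    Fin.succ_one_eq_two, Kerr.fin_succ_two_eq_three, Kerr.nullVector_apply_zero, hl1, hl2, hl3]
  -- name the atoms: `P = dψ(x)`, `m = μ(x)`, `r = r(x)`
  obtain ⟨P, hP⟩ : ∃ P : Fin 4 → ℝ, ∀ β, fderiv ℝ ψ x (E4.basisVector β) = P β :=
    ⟨_, fun _ ↦ rfl⟩
  simp only [hP]
  generalize hm : Real.smoothTransition (2 - Kerr.radius 0 x / (8 * M)) *
    (2 * Kerr.scalarH M 0 x) = m at hμ ⊢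
  generalize hr : Kerr.radius 0 x = r at hx ⊢
  have hf : 1 - m ≠ 0 := by linarith
  have hr0 : r ≠ 0 := hx.ne'
  field_simp
  ring

end Summit.FinalStateConjecture.FinalStateConjecture.Theorems
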